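import Summits.QuantumFields.BalabanUV.Beta.FP.RoadLeftLiteralStraight
import Summits.QuantumFields.BalabanUV.Beta.RowD1JointEndSymWard

/-!
# `BalabanUV.Beta.FP.RoadLeftLiteralWard` — road «FP» for binder row D1: THE TERMINAL END AT THE LITERAL WITH THE WARD DOOR `hWj` OPENED DOWN TO
# an2's SECOND-ORDER TABLE LETTERS (owner d1-p3 g11 SEAT-CLOSING, successor trigger (a) «an2 lands a `JsB12Sym` Ward END (N4 ⇒ table letters) → file the link
# `FP/RoadLeftLiteralWard` replacing `hWj` by an2's displayed table letters»; FIRED by row-D1 OWNER an2 g29: `WardLocusSymSecondOrder` ∕ `RowD1JointEndSymWard`)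

HONEST DEPENDENCY (page 1, mandatory): continuum YM on T⁴ ⇐ BetaPertH ∧ nine spine estimates (0/9 proved); BetaPertH ⇐ (D1) ∧ (D4) ∧ CAP+tail;
G-an2-4 gates asym, D1 and NE2/3/4.  HONEST FRAMING (cell contract, verbatim): «discharging `BetaPertH` makes Bałaban's UV stability UNCONDITIONAL —
a real constructive-QFT result; it is NOT the continuum limit and NOT the Clay problem.»  THIS MODULE is [our object] COMPOSITION BY NAME (one chain link
downstream of `RoadLeftLiteralStraight`, through the row-D1 OWNER's second-order Ward chain at the (0.4) literal `WardLocusSymSecondOrder.exists_kernelLaws_WsymOf_of_letters`,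
the socket discharges of `RowD1JointEndSymShift` §8–§9 ∕ `DshAn1End` §7, and leaf-04's hW END `KernelWardSymEnd.wardTransversal_flipK_TbalOf_dressSymCtr_rel_parity`);
no `def`, no `def … : Prop`, nothing cited, 0 sorry.
§1 `hWj_JsB12Sym_of_wardTables`: **`∀ j, WardTransversal (flipK (TbalOf Lc (JsB12Sym hLc N tabs cΛ cB) j))` from EXACTLY the hW-side binders of the row root
`RowD1JointEndSymWard.d1Drift_JsB12Sym_of_an1Shift_wardTables_reflLetters_D1Tel_D1Rep`** (VERBATIM): (S-V)⁰⁴ `hVd04`; (c1) `hc1`; (Sp)(Mp); the second-order letters'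
remainders `RW RW'' RB RB'' RM` with classes `hcls0`∕`hclsS` and row parities; (T2-W) `hWil`∕`hWil''`; (T2-B) `hBord0`∕`hBord0''`∕`hBordS`∕`hBordS''`; (T2-M₂) `hM₂` —
the hW sub-chain the owner's `D1Drift` ENDs carry INLINE, cut out as ONE theorem by name (S1 ⇒ (Wd) at `X₂ʷ := 0` ⇒ the parity-form hW END at the shifted
straight spread `bhKStepSh 3 Lc (Dsh Lc) j` ∕ `symEc Lc`, every socket a THEOREM; `JsB12Sym = fun j ↦ dressSymAt ctr (JsB12Sym0 … j)` unfolds).  The Ward-door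
twin of leaf-01's `RoadLeftLiteralSwap.hTj_JsB12Sym`.
§2 `d1Drift_JsB12Sym_of_sliceLedger_straight_wardTables`: **the TERMINAL END of record `RoadLeftLiteralStraight.d1Drift_JsB12Sym_of_sliceLedger_straight` with the
binder `hWj` GONE and the table letters IN ITS PLACE** (inserted where `hWj` stood; `N ↦ Ncol` in the two Wilson letters, the END's `N : ℝ` being the colour number;
every other binder VERBATIM, transcribed from the tree bytes by script); proof = the Straight END at `hWj := hWj_JsB12Sym_of_wardTables …`.  AFTER THIS LINK the
road-FP END's Ward door reads the SAME letters as the row root (chain `_rows → _rows_letters → RowsLetters → Ghost → SRecord → Straight → Ward`).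
STILL DISPLAYED: `Wt` + `hWt1`, the (CONV-C) rows, the gluon∕ghost∕slice∕ledger blocks, `hSDF` (the shared crux), the W-split letters, PART 3b, `hslice`, `hKcov`,
the (ASYMP)-side data — AND the table letters themselves (letters about an1's table VALUES; (c1)'s K part not yet typed, per an2).  0∕4 row-D1 binders; discharges
NO table letter and NO estimate; NOT hWj's CONTENT, NOT (Kcov), NOT (CONV-C), NOT X1, NOT SDF, NOT hslice, NOT (ASYMP), NOT D1, NOT BetaPertH, NOT continuum, NOT Clay.
ABSOLUTE RULE (cell charter, verbatim): «No internally-minted statement may enter as a cited fact. Every hypothesis is either kernel-proved in this package or a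
verbatim quotation of a PUBLISHED theorem with page reference. The manuscript(s) under audit are NOT citable for their own disputed steps — they are the thing
under adjudication; programme-internal (2001/route/tribunal) claims are never citable.»  «not in print; our bookkeeping».
Provenance: D1 formalisation swarm LEAF PROVER 02, unit b2b-balaban-beta-d1-formalise-leaf-02 gen 12, 2026-08-21 (owner trigger (a); INTENT journal 11:36Z;
first refusal leaf-06∕an2 honoured).  No existing file touched.
-/

noncomputable section

namespace Summit.QuantumFields.BalabanUV.Beta.FP.RoadLeftLiteralWard

open Finset Literature.MathematicalPhysics.QuantumFieldTheory Literature.MathematicalPhysics.QuantumFieldTheory.Balaban1983to89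
  Literature.MathematicalPhysics.QuantumFieldTheory.Balaban1983to89.Beta Summit.QuantumFields.BalabanUV.Beta.TameKernelCalculus
open scoped BigOperators
open Literature.MathematicalPhysics.QuantumFieldTheory.Balaban1983to89.Beta.BubbleTransfer (c4)
open B12Sec2to5 (l1)
open PolarizationSign (AxisReflectionCovariant WardTransversal)
open ExpKernelCalculus (Site MKer BiLoc comp shiftK tr tadpole bubble hessKer VertexFamily VertexFamily₂)
open KernelWard (Bdd divV divW)
open KernelReflection (refK)
open OneStepResolventKernel (Fib LocStencil JetData)
open OneStepKernelFamily (KInvStep flipK colH vertexOfK D1Drift TbalOf)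
open AffineAveraging (box toSite)
open AveragingContoursRooted (ctr ctrOff ctrOff_mem_box)
open StepJetData (mfNeg wilsonA)
open BalabanStepJetsSucc (wVH)
open SecondOrderResponse (dM vertex2OfK)
open BalabanStepW2 (M2Of wB2)
open WilsonBiStencil (wilsonW₂)
open WilsonVertex2Sym (wsym22)
open DyadicShell (Pt supNorm)
open LeadingCoefficient (kappaBal)
open DressedMomentNormalisation (dressedEntry)
open Summit.QuantumFields.BalabanUV.Beta.ChartConjugation (conjV conjW)
open Summit.QuantumFields.BalabanUV.Beta.AxialDressingRooted (one_le_of_neZero)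
open Summit.QuantumFields.BalabanUV.Beta.SymmetrisedDressingKernel (coDressKSymAt)
open Summit.QuantumFields.BalabanUV.Beta.AveragingWardRootedStencils (legInd)
open Summit.QuantumFields.BalabanUV.Beta.SymmetrisedStepJets (SymTables Gsym SsymOf SpureSymOf JsSym0Of_S JsSym0Of_W JsB12Sym0 JsB12Sym0_eq JsB12Sym
  JsB12Sym0_S_translate JsB12Sym0_W_translate)
open Summit.QuantumFields.BalabanUV.Beta.SymShiftedSpread (bhKStepSh spr_bhKStepSh)
open Summit.QuantumFields.BalabanUV.Beta.SymSliceProjectorKernel (symEc)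
open Summit.QuantumFields.BalabanUV.Beta.SymSliceProjectorSpread (spr_symEc)
open Summit.QuantumFields.BalabanUV.Beta.BorderedHessian (sgnK bhK bhKStep stepScale diagK)
open Summit.QuantumFields.BalabanUV.Beta.KernelWardRelative (loc_zero comp_zero_left)
open StepDriftWitness (comp_zero_right)
open Summit.QuantumFields.BalabanUV.Beta.WardLocusRecursiveStep (conjW_zero_zero_zero)
open Summit.QuantumFields.BalabanUV.Beta.DshAn1 (Dsh spr_Dsh comp_comp_symEc_Dsh_symEc linSym04At hVd_iff)
open Summit.QuantumFields.BalabanUV.Beta.WardLocusSymSecondOrder (exists_kernelLaws_WsymOf_of_letters)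
open Summit.QuantumFields.BalabanUV.Beta.RelInvNullShift (relInv_coDressKSymAt_KInvStep_bhKStep_add)
open Summit.QuantumFields.BalabanUV.Beta.WardLocusSymShift (hSd_JsB12Sym0)
open Summit.QuantumFields.BalabanUV.Beta.KernelWardHColumnSym (colH_ward_coDressKSymAt_KInvStep)
open Summit.QuantumFields.BalabanUV.Beta.KernelWardLevels (loc_diagK_smul_sum_legInd)
open Summit.QuantumFields.BalabanUV.Beta.SymSliceProjectorDiagComm (comp_symEc_blockGen_comm)
open Summit.QuantumFields.BalabanUV.Beta.KernelWardSymEnd (wardTransversal_flipK_TbalOf_dressSymCtr_rel_parity)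
open Summit.QuantumFields.BalabanUV.Beta.HessKerDressedUnits (unitS unitW)
open Summit.QuantumFields.BalabanUV.Beta.GAN24.CombesThomas (sfStep smStep)
open Summit.QuantumFields.BalabanUV.Beta.D1BFx.MomentTransferPeriodicEntry (EKer₂ dressedEntryP)
open Summit.QuantumFields.BalabanUV.Beta.D1BFx.ReducedKernelSandwichLeg (fineHessA)
open Summit.QuantumFields.BalabanUV.Beta.D1BFx.PackedKernelSplit (blk)
open Summit.QuantumFields.BalabanUV.Beta.D1BFx.GhostStencil (ghCur)
open Summit.QuantumFields.BalabanUV.Beta.D1BFx.ReducedKernelSandwichBlock (diagExt)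
open Summit.QuantumFields.BalabanUV.Beta.D1BFx.GhostStencilReflection (ghX)
open Summit.QuantumFields.BalabanUV.Beta.FP.PerfectObjectsT (KPerf SPerfOf WPerfOf)
open Summit.QuantumFields.BalabanUV.Beta.FP.TransportInfinityM (colOf)
open Summit.QuantumFields.BalabanUV.Beta.FP.StepDefectInherit (defect)
open Summit.QuantumFields.BalabanUV.Beta.FP.WilsonCubicGerm (cubicGermOf)
open Summit.QuantumFields.BalabanUV.Beta.FP.BubbleGermValue (bfGerm)
open Summit.QuantumFields.BalabanUV.Beta.FP.PerfectPolarization (Pker G0ker PiBF)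
open Summit.QuantumFields.BalabanUV.Beta.FP.RoadLeftLiteralStraight (d1Drift_JsB12Sym_of_sliceLedger_straight)
variable {Lc : ℕ} [NeZero Lc]

/-! ## §1 The Ward door of the wall family at the literal, from the table letters -/
/-- **THE WARD DOOR OF THE WALL FAMILY AT THE LITERAL, FROM THE TABLE LETTERS** [our object]: `∀ j, WardTransversal (flipK (TbalOf Lc (JsB12Sym hLc N tabs cΛ cB) j))`
⟸ EXACTLY the hW-side binders of the row root `RowD1JointEndSymWard.d1Drift_JsB12Sym_of_an1Shift_wardTables_reflLetters_D1Tel_D1Rep` (VERBATIM: (S-V)⁰⁴, (c1), (Sp)(Mp),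
remainders `RW RW'' RB RB'' RM` + classes + row parities, (T2-W), (T2-B), (T2-M₂)).  Proof = the owner's inline hW sub-chain by name (`exists_kernelLaws_WsymOf_of_letters` ⇒
(Wd) at `X₂ʷ := 0` ⇒ `KernelWardSymEnd.wardTransversal_flipK_TbalOf_dressSymCtr_rel_parity`, sockets by theorems).  HONEST: composition; discharges NO table letter. -/
theorem hWj_JsB12Sym_of_wardTables (hLc : Odd Lc) (N : ℕ) (tabs : SymTables 3 Lc) (cΛ cB : ℝ)
    -- hW, first order: the (0.4) stencil Ward law of `tabs.V` ((S-V)⁰⁴, an1's `hVd_iff` form of (V-d))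
    (hVd04 : ∀ u : Fin 4 → ℤ, divV tabs.V u = conjV (mfNeg (linSym04At (ctr 4 Lc) Lc)) (diagK (legInd (ctr 4 Lc) u)))
    -- hW, SECOND ORDER — THE TABLE LETTERS replacing the (Wd) socket of the root of record:
    -- (c1) the order-one consistency of the multiplier table with the Λ-sector at the symmetrised resolvents, every level
    (hc1 : ∀ (j : ℕ) (κ : Fin 4) (u : Fin 4 → ℤ),
      dM (Gsym Lc j) Lc (SpureSymOf tabs ((Lc : ℝ) ^ (3 + 1)) (-((Lc : ℝ) ^ (3 + 1) * (1 / 2) * (Lc : ℝ) ^ (3 + 1))) cΛ j) (tabs.M j) κ u = vertexOfK (Gsym Lc j) Lc (SsymOf tabs ((Lc : ℝ) ^ (3 + 1)) (-((Lc : ℝ) ^ (3 + 1) * (1 / 2) * (Lc : ℝ) ^ (3 + 1))) cΛ j) κ u)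
    -- (Sp)(Mp) the row parities of the first-order tables
    (hSp : ∀ (j : ℕ) (κ : Fin 4) (u : Fin 4 → ℤ), trK (SpureSymOf tabs ((Lc : ℝ) ^ (3 + 1)) (-((Lc : ℝ) ^ (3 + 1) * (1 / 2) * (Lc : ℝ) ^ (3 + 1))) cΛ j κ u) = -sgnK (SpureSymOf tabs ((Lc : ℝ) ^ (3 + 1)) (-((Lc : ℝ) ^ (3 + 1) * (1 / 2) * (Lc : ℝ) ^ (3 + 1))) cΛ j κ u))
    (hMp : ∀ (j : ℕ) (ρ : Fin 4) (w : Fin 4 → ℤ), trK (tabs.M j ρ w) = -sgnK (tabs.M j ρ w))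
    -- the second-order letters' remainders, their classes (one rate per level) and row parities
    (RW RW'' : (Fin 4 → ℤ) → Fin 4 → (Fin 4 → ℤ) → MKer 4 (Fib 3))
    (RB RB'' : ℕ → (Fin 4 → ℤ) → Fin 4 → (Fin 4 → ℤ) → MKer 4 (Fib 3))
    (RM : ℕ → (Fin 4 → ℤ) → Fin 4 → (Fin 4 → ℤ) → MKer 4 (Fib 3))
    (hcls0 : ∃ C δ : ℝ, 0 < δ ∧ (∀ Y, LocStencil (RW Y) C δ) ∧ (∀ Y, LocStencil (RW'' Y) C δ) ∧ (∀ Y, LocStencil (RB 0 Y) C δ) ∧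
      (∀ Y, LocStencil (RB'' 0 Y) C δ) ∧ (∀ y, VertexFamily (RM 0 y) Lc C δ))
    (hclsS : ∀ j : ℕ, ∃ C δ : ℝ, 0 < δ ∧ (∀ Y, LocStencil (RB (j + 1) Y) C δ) ∧ (∀ Y, LocStencil (RB'' (j + 1) Y) C δ) ∧
      (∀ y, VertexFamily (RM (j + 1) y) Lc C δ))
    (hRWp : ∀ Y κ u, trK (RW Y κ u) = -sgnK (RW Y κ u)) (hRW''p : ∀ Y κ u, trK (RW'' Y κ u) = -sgnK (RW'' Y κ u))
    (hRBp : ∀ j Y κ u, trK (RB j Y κ u) = -sgnK (RB j Y κ u)) (hRB''p : ∀ j Y κ u, trK (RB'' j Y κ u) = -sgnK (RB'' j Y κ u))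
    (hRMp : ∀ j y ρ' w, trK (RM j y ρ' w) = -sgnK (RM j y ρ' w))
    -- (T2-W) the level-0 Ward law of the Wilson bi-table `Lc⁸ • wilsonW₂ 3 ((8N²)⁻¹ • wsym22 N)` against `Lc⁴ • wilsonA 3`, both slots
    (hWil : ∀ (Y : Fin 4 → ℤ) (κ' : Fin 4) (u' : Fin 4 → ℤ),
      (stepScale 3 Lc 0 * (Lc : ℝ) ^ (3 + 1))⁻¹ • ∑ v ∈ box (3 + 1) Lc,
          divV (fun κ u => ((Lc : ℝ) ^ 8) • wilsonW₂ 3 ((8 * (N : ℝ) ^ 2)⁻¹ • wsym22 N) κ u κ' u') ((Lc : ℤ) • Y + toSite v) =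
        comp (((Lc : ℝ) ^ (3 + 1)) • wilsonA 3 κ' u') (diagK ((1 / 2 : ℝ) • ∑ v ∈ box (3 + 1) Lc, legInd (ctr (3 + 1) Lc) ((Lc : ℤ) • Y + toSite v)))
          - comp (diagK ((1 / 2 : ℝ) • ∑ v ∈ box (3 + 1) Lc, legInd (ctr (3 + 1) Lc) ((Lc : ℤ) • Y + toSite v))) (((Lc : ℝ) ^ (3 + 1)) • wilsonA 3 κ' u') + RW Y κ' u')
    (hWil'' : ∀ (Y : Fin 4 → ℤ) (κ : Fin 4) (u : Fin 4 → ℤ),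
      (stepScale 3 Lc 0 * (Lc : ℝ) ^ (3 + 1))⁻¹ • ∑ v ∈ box (3 + 1) Lc,
          divV (fun κ' u' => ((Lc : ℝ) ^ 8) • wilsonW₂ 3 ((8 * (N : ℝ) ^ 2)⁻¹ • wsym22 N) κ u κ' u') ((Lc : ℤ) • Y + toSite v) =
        comp (((Lc : ℝ) ^ (3 + 1)) • wilsonA 3 κ u) (diagK ((1 / 2 : ℝ) • ∑ v ∈ box (3 + 1) Lc, legInd (ctr (3 + 1) Lc) ((Lc : ℤ) • Y + toSite v)))
          - comp (diagK ((1 / 2 : ℝ) • ∑ v ∈ box (3 + 1) Lc, legInd (ctr (3 + 1) Lc) ((Lc : ℤ) • Y + toSite v))) (((Lc : ℝ) ^ (3 + 1)) • wilsonA 3 κ u) + RW'' Y κ u)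
    -- (T2-B) the Ward law of the second-order border table `tabs.vh₂S` against `tabs.V`, both slots, level 0 and level j+1
    (hBord0 : ∀ (Y : Fin 4 → ℤ) (κ' : Fin 4) (u' : Fin 4 → ℤ),
      (stepScale 3 Lc 0 * (Lc : ℝ) ^ (3 + 1))⁻¹ • ∑ v ∈ box (3 + 1) Lc, divV (fun κ u => cB • tabs.vh₂S κ u κ' u') ((Lc : ℤ) • Y + toSite v) =
        comp ((-((Lc : ℝ) ^ (3 + 1) * (1 / 2) * (Lc : ℝ) ^ (3 + 1))) • tabs.V κ' u') (diagK ((1 / 2 : ℝ) • ∑ v ∈ box (3 + 1) Lc, legInd (ctr (3 + 1) Lc) ((Lc : ℤ) • Y + toSite v)))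
          - comp (diagK ((1 / 2 : ℝ) • ∑ v ∈ box (3 + 1) Lc, legInd (ctr (3 + 1) Lc) ((Lc : ℤ) • Y + toSite v))) ((-((Lc : ℝ) ^ (3 + 1) * (1 / 2) * (Lc : ℝ) ^ (3 + 1))) • tabs.V κ' u') + RB 0 Y κ' u')
    (hBord0'' : ∀ (Y : Fin 4 → ℤ) (κ : Fin 4) (u : Fin 4 → ℤ),
      (stepScale 3 Lc 0 * (Lc : ℝ) ^ (3 + 1))⁻¹ • ∑ v ∈ box (3 + 1) Lc, divV (fun κ' u' => cB • tabs.vh₂S κ u κ' u') ((Lc : ℤ) • Y + toSite v) =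
        comp ((-((Lc : ℝ) ^ (3 + 1) * (1 / 2) * (Lc : ℝ) ^ (3 + 1))) • tabs.V κ u) (diagK ((1 / 2 : ℝ) • ∑ v ∈ box (3 + 1) Lc, legInd (ctr (3 + 1) Lc) ((Lc : ℤ) • Y + toSite v)))
          - comp (diagK ((1 / 2 : ℝ) • ∑ v ∈ box (3 + 1) Lc, legInd (ctr (3 + 1) Lc) ((Lc : ℤ) • Y + toSite v))) ((-((Lc : ℝ) ^ (3 + 1) * (1 / 2) * (Lc : ℝ) ^ (3 + 1))) • tabs.V κ u) + RB'' 0 Y κ u)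
    (hBordS : ∀ (j : ℕ) (Y : Fin 4 → ℤ) (κ' : Fin 4) (u' : Fin 4 → ℤ),
      (stepScale 3 Lc (j + 1) * (Lc : ℝ) ^ (3 + 1))⁻¹ • ∑ v ∈ box (3 + 1) Lc, divV (fun κ u => (cB * wB2 3 Lc (j + 1)) • tabs.vh₂S κ u κ' u') ((Lc : ℤ) • Y + toSite v) =
        comp (((-((Lc : ℝ) ^ (3 + 1) * (1 / 2) * (Lc : ℝ) ^ (3 + 1))) * wVH 3 Lc (j + 1)) • tabs.V κ' u') (diagK ((1 / 2 : ℝ) • ∑ v ∈ box (3 + 1) Lc, legInd (ctr (3 + 1) Lc) ((Lc : ℤ) • Y + toSite v)))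
          - comp (diagK ((1 / 2 : ℝ) • ∑ v ∈ box (3 + 1) Lc, legInd (ctr (3 + 1) Lc) ((Lc : ℤ) • Y + toSite v))) (((-((Lc : ℝ) ^ (3 + 1) * (1 / 2) * (Lc : ℝ) ^ (3 + 1))) * wVH 3 Lc (j + 1)) • tabs.V κ' u') + RB (j + 1) Y κ' u')
    (hBordS'' : ∀ (j : ℕ) (Y : Fin 4 → ℤ) (κ : Fin 4) (u : Fin 4 → ℤ),
      (stepScale 3 Lc (j + 1) * (Lc : ℝ) ^ (3 + 1))⁻¹ • ∑ v ∈ box (3 + 1) Lc, divV (fun κ' u' => (cB * wB2 3 Lc (j + 1)) • tabs.vh₂S κ u κ' u') ((Lc : ℤ) • Y + toSite v) =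
        comp (((-((Lc : ℝ) ^ (3 + 1) * (1 / 2) * (Lc : ℝ) ^ (3 + 1))) * wVH 3 Lc (j + 1)) • tabs.V κ u) (diagK ((1 / 2 : ℝ) • ∑ v ∈ box (3 + 1) Lc, legInd (ctr (3 + 1) Lc) ((Lc : ℤ) • Y + toSite v)))
          - comp (diagK ((1 / 2 : ℝ) • ∑ v ∈ box (3 + 1) Lc, legInd (ctr (3 + 1) Lc) ((Lc : ℤ) • Y + toSite v))) (((-((Lc : ℝ) ^ (3 + 1) * (1 / 2) * (Lc : ℝ) ^ (3 + 1))) * wVH 3 Lc (j + 1)) • tabs.V κ u) + RB'' (j + 1) Y κ u)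
    -- (T2-M₂) the Ward law of the mixed table `M2Of tabs.mixFF j` against `tabs.M j`, every level
    (hM₂ : ∀ (j : ℕ) (y : Fin 4 → ℤ) (ρ' : Fin 4) (w : Fin 4 → ℤ),
      (stepScale 3 Lc j * (Lc : ℝ) ^ (3 + 1))⁻¹ • ∑ v ∈ box (3 + 1) Lc, divV (fun κ u => M2Of 3 Lc tabs.mixFF j κ u ρ' w) ((Lc : ℤ) • y + toSite v) =
        comp (tabs.M j ρ' w) (diagK ((1 / 2 : ℝ) • ∑ v ∈ box (3 + 1) Lc, legInd (ctr (3 + 1) Lc) ((Lc : ℤ) • y + toSite v))) - comp (diagK ((1 / 2 : ℝ) • ∑ v ∈ box (3 + 1) Lc, legInd (ctr (3 + 1) Lc) ((Lc : ℤ) • y + toSite v))) (tabs.M j ρ' w) + RM j y ρ' w) :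
    ∀ j : ℕ, WardTransversal (flipK (TbalOf Lc (JsB12Sym hLc N tabs cΛ cB) j)) := by
  have hLc1 : 1 ≤ Lc := one_le_of_neZero Lc
  have hVd := (hVd_iff Lc (divV tabs.V)).2 hVd04
  have hcE₂ : ((Lc : ℝ) ^ 8) = (Lc : ℝ) ^ (2 * (3 + 1)) := by norm_num
  -- the second-order Ward kernel law of the literal's W-tables from the table letters (an2's S1)
  obtain ⟨Nr, hcls, hpar, hlaw⟩ := exists_kernelLaws_WsymOf_of_letters (d := 3) tabs (spr_Dsh hLc1) (comp_comp_symEc_Dsh_symEc hLc1) hVd cΛ cB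
    hcE₂ ((8 * (N : ℝ) ^ 2)⁻¹ • wsym22 N) hc1 hSp hMp hcls0 hclsS hRWp hRW''p hRBp hRB''p hRMp hWil hWil'' hBord0 hBord0'' hBordS hBordS'' hM₂
  have epin : -((Lc : ℝ) ^ (3 + 1) * (1 / 2) * (Lc : ℝ) ^ (3 + 1)) = -((Lc : ℝ) ^ 8 / 2) := by ring
  -- the (Wd) socket in the hW END's shape, with `X₂ʷ := 0`
  have hWd : ∀ (j : ℕ) (y : Fin 4 → ℤ) (ν : Fin 4) (y' : Fin 4 → ℤ),
      divW (JsB12Sym0 hLc N tabs cΛ cB j).W y ν y' =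
        conjW (bhKStepSh 3 Lc (Dsh Lc) j) 0 (vertexOfK (coDressKSymAt (toSite (ctrOff 4 Lc)) Lc (KInvStep (d := 3) Lc j)) Lc (JsB12Sym0 hLc N tabs cΛ cB j).S ν y')
          (diagK ((1 / 2 : ℝ) • ∑ v ∈ box 4 Lc, legInd (ctr 4 Lc) ((Lc : ℤ) • y + toSite v))) 0 0 + Nr j y ν y' := by
    intro j y ν y'
    have h1 := hlaw j y ν y'
    rw [hc1 j ν y', epin] at h1
    rw [conjW_zero_zero_zero, JsB12Sym0_eq, JsSym0Of_W, JsSym0Of_S]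
    exact h1
  have hEX₂ : ∀ (j : ℕ) (y : Fin 4 → ℤ) (ν : Fin 4) (y' : Fin 4 → ℤ), comp (symEc Lc) (0 : MKer 4 (Fib 3)) = comp (0 : MKer 4 (Fib 3)) (symEc Lc) := by
    intro j y ν y'
    rw [comp_zero_left, comp_zero_right]
  -- leaf-04's parity-form hW END at the shifted straight spread of record, every socket a theorem
  exact wardTransversal_flipK_TbalOf_dressSymCtr_rel_parity (JsB12Sym0 hLc N tabs cΛ cB)
    (fun j => bhKStepSh 3 Lc (Dsh Lc) j) (symEc Lc) (spr_bhKStepSh (spr_Dsh hLc1)) (spr_symEc hLc1)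
    (fun j => relInv_coDressKSymAt_KInvStep_bhKStep_add (d := 3) (Lc := Lc) j (spr_Dsh hLc1) (comp_comp_symEc_Dsh_symEc hLc1) (stepScale 3 Lc j))
    (JsB12Sym0_S_translate hLc N tabs cΛ cB) (JsB12Sym0_W_translate hLc N tabs cΛ cB)
    (fun j => (stepScale 3 Lc j * (Lc : ℝ) ^ (3 + 1))⁻¹)
    (fun j y κ' u => colH_ward_coDressKSymAt_KInvStep (d := 3) (Lc := Lc) j y κ' u)
    (fun _ y => diagK ((1 / 2 : ℝ) • ∑ v ∈ box 4 Lc, legInd (ctr 4 Lc) ((Lc : ℤ) • y + toSite v)))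
    (fun _ y => loc_diagK_smul_sum_legInd Lc (ctr 4 Lc) (1 / 2 : ℝ) y)
    (fun _ y => comp_symEc_blockGen_comm hLc1 (ctr 4 Lc) (1 / 2 : ℝ) y)
    (fun _ _ _ _ => 0) Nr (fun _ _ _ _ => loc_zero)
    (fun j y ν y' => by obtain ⟨C, δ, hδ, h⟩ := hcls j; exact ⟨_, _, _, δ, hδ, h y ν y'⟩) hEX₂
    (hSd_JsB12Sym0 hLc N tabs cΛ cB (spr_Dsh hLc1) (comp_comp_symEc_Dsh_symEc hLc1) hVd) hWd hpar

/-! ## §2 The terminal END of road FP with the Ward door opened down to the table letters -/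
/-- **ROAD «FP» — THE TERMINAL END AT THE LITERAL, WARD DOOR OPENED DOWN TO THE TABLE LETTERS** [our object]: `RoadLeftLiteralStraight.d1Drift_JsB12Sym_of_sliceLedger_straight`
with the binder `hWj` GONE and, in its place, the hW-side TABLE LETTERS of the row root (VERBATIM, `N ↦ Ncol`); every other binder VERBATIM.  Proof: the Straight END at
`hWj := hWj_JsB12Sym_of_wardTables …`.  CONCLUSION: `D1Drift Lc (JsB12Sym hOdd Ncol tabs cΛ cB) N μ ν`.  HONEST: composition by name; discharges NO table letter. -/
theorem d1Drift_JsB12Sym_of_sliceLedger_straight_wardTables (hLc : 2 ≤ Lc) (hOdd : Odd Lc) (Ncol : ℕ) (tabs : SymTables 3 Lc) (cΛ cB : ℝ)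
    -- the (j, m)-families of the literal's stencils ∕ second-order tables, pinned at m = 1
    -- R-FP-41: the S-family of record is `S j m := (JsB12Sym hOdd Ncol tabs cΛ cB j).S` (m-independent) — PINNED inside, not displayed
    (Wt : ℕ → ℕ → Fin (3 + 1) → (Fin (3 + 1) → ℤ) → Fin (3 + 1) → (Fin (3 + 1) → ℤ) → MKer (3 + 1) (Fib 3))
    (hWt1 : ∀ j, Wt j 1 = (JsB12Sym hOdd Ncol tabs cΛ cB j).W)
    -- (CONV-C) S-slot and W-slot rows of the UNDRESSED unit-rescaled jets of `JsB12Sym0` (row G-an2-4; HYPOTHESES; the dressing is bookkeeping,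
    -- `RoadEndLeftUndressed` §2)
    {Cs0 cS δS θS Cw0 cW δW θW : ℝ}
    (hS0 : ∀ j, LocStencil (unitS (sfStep Lc j) (smStep 3 Lc j) (JsB12Sym0 hOdd Ncol tabs cΛ cB j).S) Cs0 δS)
    (hSall0 : ∀ k j, LocStencil (unitS (sfStep Lc (k + j)) (smStep 3 Lc (k + j)) (JsB12Sym0 hOdd Ncol tabs cΛ cB (k + j)).S -
      unitS (sfStep Lc k) (smStep 3 Lc k) (JsB12Sym0 hOdd Ncol tabs cΛ cB k).S) (cS * θS ^ k) δS)
    (hW0 : ∀ j, VertexFamily₂ (unitW (sfStep Lc j) (smStep 3 Lc j) (JsB12Sym0 hOdd Ncol tabs cΛ cB j).W) Lc Cw0 δW)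
    (hWall0 : ∀ k j, VertexFamily₂ (unitW (sfStep Lc (k + j)) (smStep 3 Lc (k + j)) (JsB12Sym0 hOdd Ncol tabs cΛ cB (k + j)).W -
      unitW (sfStep Lc k) (smStep 3 Lc k) (JsB12Sym0 hOdd Ncol tabs cΛ cB k).W) Lc (cW * θW ^ k) δW)
    (hδS : 0 < δS) (hδW : 0 < δW) (hθS0 : 0 ≤ θS) (hθS1 : θS < 1) (hθW0 : 0 ≤ θW) (hθW1 : θW < 1)
    -- the BF comparison data: colour weights and the admissible families (PART 3b's list starts here)
    (wg wgh : ℝ)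
    {V : Fin 4 → Site 4 → MKer 4 (Fib 3)} {W : Fin 4 → Site 4 → Fin 4 → Site 4 → MKer 4 (Fib 3)} {Cv Cw Cx CwL cQ δ : ℝ} (hδ : 0 < δ)
    -- admissible-family letters, gluon sector — STRAIGHT: every letter at the leg `Pkerˢˢ := fun x z a b => Pker z x a b` (R-FP-42)
    (hV : ∀ (μ : Fin 4) (y : Site 4), BiLoc (V μ y) y y Cv δ) (hW : ∀ (μ : Fin 4) (y : Site 4) (ν : Fin 4) (y' : Site 4), BiLoc (W μ y ν y') y y' Cw δ)
    (hcovV : ∀ (μ : Fin 4) (y t : Site 4), V μ (y + t) = shiftK (-t) (V μ y))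
    (hcovW : ∀ (μ : Fin 4) (y : Site 4) (ν : Fin 4) (y' t : Site 4), W μ (y + t) ν (y' + t) = shiftK (-t) (W μ y ν y'))
    (X : Site 4 → MKer 4 (Fib 3)) (hX : ∀ y, BiLoc (X y) y y Cx δ)
    (hW1 : ∀ y, comp (comp (fun x z a b => Pker z x a b) (divV V y)) (fun x z a b => Pker z x a b)
      = comp (fun x z a b => Pker z x a b) (X y) - comp (X y) (fun x z a b => Pker z x a b))
    (hW2 : ∀ y ν y', divW W y ν y' = comp (X y) (V ν y') - comp (V ν y') (X y))
    -- (Kcov) of the STRAIGHT BF comparison kernel (= `PiBF` over the relabelled data, `LegShiftDictionary.PiBF_legShift`), ghost sector AT THE EXPLICIT PAIR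
    -- `(ghCur, diagExt (−ghX))` — DISPLAYED (gluon half: leaf-02's R13 `SliceKcovStraight` §3 shape; ghost half: leaf-01's `GhostBiTableReflection`)
    (hKcov : AxisReflectionCovariant (flipK (fun μ ν z => wg * hessKer (fun x z a b => Pker z x a b) V W μ ν z
      - wgh * hessKer G0ker ghCur (diagExt fun κ u => (-1 : ℝ) • ghX κ u) μ ν z)))
    (h0V : ∀ (lam α β : Fin 4), ∑' p : Pt × Pt, V lam 0 p.1 p.2 (Sum.inl α) (Sum.inl β) = 0)
    (hgermV : cubicGermOf V = cQ • bfGerm)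
    (hWloc : ∀ (μ ν : Fin 4) (z : Pt), BiLoc (W μ 0 ν z) 0 z (CwL * Real.exp (-δ * l1 z)) δ)
    -- (the ghost-sector letters `hv hw hcovv hcovw hXg hW1g hW2g h0v hgermv hwloc` are THEOREMS at `(ghCur, diagExt (−ghX), −projU)` —
    -- `GhostBiTableLaw` ∕ `GhostCubicGerm` ∕ `GhostGaugeLaw` — and are supplied INSIDE)
    -- the colour weights and the entry
    {N : ℝ} (hn : (40 * wg * (1 / 4 : ℝ) * (c4 * cQ) ^ 2 - wgh * (-(1 / 2 : ℝ)) * c4 ^ 2) / 3 = kappaBal N)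
    {μ ν : Fin 4} (hμν : μ ≠ ν)
    -- the X1m-S rows of `RoadLeftLiteralRows` (`hSm hSmall hθm hδsm hcov2`) are DISCHARGED at the S-family of record from `hS0 hSall0 hθS1 hδS`
    {Wf : ℕ → Fin (3 + 1) → (Fin (3 + 1) → ℤ) → Fin (3 + 1) → (Fin (3 + 1) → ℤ) → MKer (3 + 1) (Fib 3)}
    (hWf : ∀ m : ℕ, 1 ≤ m → ∃ C2 δ2 : ℝ, 0 < δ2 ∧ (∀ κ' u l' u', BiLoc (Wf m κ' u l' u') u u' C2 δ2) ∧
      ∀ κ' u l' u' t, Wf m κ' (u + ((Lc ^ m : ℕ) : ℤ) • t) l' (u' + ((Lc ^ m : ℕ) : ℤ) • t)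
        = shiftK (-(((Lc ^ m : ℕ) : ℤ) • t)) (Wf m κ' u l' u'))
    -- the FAR LETTER of the full fine kernel (m-free shape)
    {CF af : ℝ} (hCF : 0 ≤ CF) (haf : 0 < af)
    (hfar : ∀ m : ℕ, 1 ≤ m → ∀ (c e : Fin 4) (s s' : Pt), Lc ^ m < supNorm (s' - s) →
      |fineHessA (KPerf (d := 3) Lc (sfStep Lc) (smStep 3 Lc) m) (SPerfOf (sfStep Lc) (smStep 3 Lc) (fun j _ =>
        (JsB12Sym hOdd Ncol tabs cΛ cB j).S) m) (Wf m) c e s s'|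
        ≤ ((Lc ^ m : ℕ) : ℝ) ^ 8 * (CF / (supNorm (s' - s) : ℝ) ^ 6 * Real.exp (-(af / ((Lc ^ m : ℕ) : ℝ)) * (supNorm (s' - s) : ℝ))))
    -- THE DISPLAYED SLICE DATA per `m` — STRAIGHT (leg `c m • blk Pkerˢˢ tt + R m`): units and bubble weight, remainder leg, slice stencils∕bi-tables, `hslice`
    {c a b κ : ℕ → ℝ} (hunits₁ : ∀ m : ℕ, 1 ≤ m → (((Lc ^ m : ℕ) : ℝ) ^ 8) * wg = c m * b m)
    (hunits₂ : ∀ m : ℕ, 1 ≤ m → (((Lc ^ m : ℕ) : ℝ) ^ 8) * wg = κ m * (c m ^ 2 * a m ^ 2))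
    {R : ℕ → MKer 4 (Fin 4)} (hRb : ∀ m : ℕ, 1 ≤ m → ∃ CR, Bdd (R m) CR)
    {Ssl : ℕ → Fin 4 → Site 4 → MKer 4 (Fin 4)} (hSsl : ∀ m : ℕ, 1 ≤ m → ∃ Cs, ∀ κ u, BiLoc (Ssl m κ u) u u Cs δ)
    {Wsl : ℕ → Fin 4 → Site 4 → Fin 4 → Site 4 → MKer 4 (Fin 4)} (hWsl : ∀ m : ℕ, 1 ≤ m → ∃ C2, ∀ κ u l u', BiLoc (Wsl m κ u l u') u u' C2 δ)
    {Fmix Fgh FN : ℕ → EKer₂ 4}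
    (hslice : ∀ m : ℕ, 1 ≤ m → ∀ (c' e : Fin 4) (s s' : Pt),
      fineHessA (KPerf (d := 3) Lc (sfStep Lc) (smStep 3 Lc) m) (SPerfOf (sfStep Lc) (smStep 3 Lc) (fun j _ =>
        (JsB12Sym hOdd Ncol tabs cΛ cB j).S) m) (Wf m) c' e s s'
        = ((1 / 2 : ℝ) * tadpole (c m • blk (fun x z a b => Pker z x a b) true true + R m) (Wsl m c' s e s')
            - (1 / 2 : ℝ) * κ m * bubble (c m • blk (fun x z a b => Pker z x a b) true true + R m) (Ssl m c' s) (Ssl m e s'))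
          + Fmix m c' e s s' + Fgh m c' e s s' + FN m c' e s s')
    -- THE DISPLAYED MIX SPLIT (α2-a PART 2) and GHOST SPLIT (α2-c) into bounded pieces, and the normalisation piece's bound
    {ιM : Type*} (JM : Finset ιM) {Gmix : ιM → ℕ → EKer₂ 4}
    (hmix : ∀ m : ℕ, 1 ≤ m → ∀ (c' e : Fin 4) (s s' : Pt),
      (if supNorm (s' - s) ≤ Lc ^ m then Fmix m c' e s s' else 0) = ∑ k ∈ JM, Gmix k m c' e s s')
    (hGmix : ∀ k ∈ JM, ∀ m : ℕ, 1 ≤ m → ∀ c' e : Fin 4, ∃ A, ∀ s s', |Gmix k m c' e s s'| ≤ A)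
    {ιG : Type*} (JG : Finset ιG) {Ggh : ιG → ℕ → EKer₂ 4}
    (hgh : ∀ m : ℕ, 1 ≤ m → ∀ (c' e : Fin 4) (s s' : Pt),
      (if supNorm (s' - s) ≤ Lc ^ m then Fgh m c' e s s'
          + ((Lc ^ m : ℕ) : ℝ) ^ 8 * wgh * fineHessA G0ker ghCur (diagExt fun κ u => (-1 : ℝ) • ghX κ u) c' e s s' else 0)
        = ∑ k ∈ JG, Ggh k m c' e s s')
    (hGgh : ∀ k ∈ JG, ∀ m : ℕ, 1 ≤ m → ∀ c' e : Fin 4, ∃ A, ∀ s s', |Ggh k m c' e s s'| ≤ A)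
    (hFN : ∀ m : ℕ, 1 ≤ m → ∀ c' e : Fin 4, ∃ A, ∀ s s', |FN m c' e s s'| ≤ A)
    -- THE (rem) LEDGER: one number per named piece — the gluon-core words STRAIGHT (`Pkerˢˢ` for `Pker`)
    {B7 : Fin 7 → ℝ} {Bmix : ιM → ℝ} {Bgh : ιG → ℝ} {BN : ℝ}
    (hL0 : ∀ m : ℕ, 1 ≤ m → ∀ S' : Finset Pt, ∑ u ∈ S', (supNorm u : ℝ) ^ 2 *
      |dressedEntryP (fun c'' a' => colH (KPerf (d := 3) Lc (sfStep Lc) (smStep 3 Lc) m) (Lc ^ m) a' 0 c'')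
        (fun c' e s s' => if supNorm (s' - s) ≤ Lc ^ m then (1 / 2 : ℝ) * tadpole (R m) (Wsl m c' s e s') else 0)
        (((Lc ^ m : ℕ) : ℤ) • (-u)) μ ν| ≤ B7 0)
    (hL1 : ∀ m : ℕ, 1 ≤ m → ∀ S' : Finset Pt, ∑ u ∈ S', (supNorm u : ℝ) ^ 2 *
      |dressedEntryP (fun c'' a' => colH (KPerf (d := 3) Lc (sfStep Lc) (smStep 3 Lc) m) (Lc ^ m) a' 0 c'')
        (fun c' e s s' => if supNorm (s' - s) ≤ Lc ^ m then
          -((1 / 2 : ℝ) * κ m) * tr (comp (comp (c m • blk (fun x z a b => Pker z x a b) true true) (Ssl m c' s)) (comp (R m) (Ssl m e s'))) else 0)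
        (((Lc ^ m : ℕ) : ℤ) • (-u)) μ ν| ≤ B7 1)
    (hL2 : ∀ m : ℕ, 1 ≤ m → ∀ S' : Finset Pt, ∑ u ∈ S', (supNorm u : ℝ) ^ 2 *
      |dressedEntryP (fun c'' a' => colH (KPerf (d := 3) Lc (sfStep Lc) (smStep 3 Lc) m) (Lc ^ m) a' 0 c'')
        (fun c' e s s' => if supNorm (s' - s) ≤ Lc ^ m then
          -((1 / 2 : ℝ) * κ m) * tr (comp (comp (R m) (Ssl m c' s)) (comp (c m • blk (fun x z a b => Pker z x a b) true true) (Ssl m e s'))) else 0)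
        (((Lc ^ m : ℕ) : ℤ) • (-u)) μ ν| ≤ B7 2)
    (hL3 : ∀ m : ℕ, 1 ≤ m → ∀ S' : Finset Pt, ∑ u ∈ S', (supNorm u : ℝ) ^ 2 *
      |dressedEntryP (fun c'' a' => colH (KPerf (d := 3) Lc (sfStep Lc) (smStep 3 Lc) m) (Lc ^ m) a' 0 c'')
        (fun c' e s s' => if supNorm (s' - s) ≤ Lc ^ m then -((1 / 2 : ℝ) * κ m) * bubble (R m) (Ssl m c' s) (Ssl m e s') else 0)
        (((Lc ^ m : ℕ) : ℤ) • (-u)) μ ν| ≤ B7 3)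
    (hL4 : ∀ m : ℕ, 1 ≤ m → ∀ S' : Finset Pt, ∑ u ∈ S', (supNorm u : ℝ) ^ 2 *
      |dressedEntryP (fun c'' a' => colH (KPerf (d := 3) Lc (sfStep Lc) (smStep 3 Lc) m) (Lc ^ m) a' 0 c'')
        (fun c' e s s' => if supNorm (s' - s) ≤ Lc ^ m then
          (1 / 2 : ℝ) * tadpole (c m • blk (fun x z a b => Pker z x a b) true true) (Wsl m c' s e s' - b m • blk (W c' s e s') true true) else 0)
        (((Lc ^ m : ℕ) : ℤ) • (-u)) μ ν| ≤ B7 4)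
    (hL5 : ∀ m : ℕ, 1 ≤ m → ∀ S' : Finset Pt, ∑ u ∈ S', (supNorm u : ℝ) ^ 2 *
      |dressedEntryP (fun c'' a' => colH (KPerf (d := 3) Lc (sfStep Lc) (smStep 3 Lc) m) (Lc ^ m) a' 0 c'')
        (fun c' e s s' => if supNorm (s' - s) ≤ Lc ^ m then
          -((1 / 2 : ℝ) * κ m) * bubble (c m • blk (fun x z a b => Pker z x a b) true true) (Ssl m c' s - a m • blk (V c' s) true true) (Ssl m e s') else 0)
        (((Lc ^ m : ℕ) : ℤ) • (-u)) μ ν| ≤ B7 5)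
    (hL6 : ∀ m : ℕ, 1 ≤ m → ∀ S' : Finset Pt, ∑ u ∈ S', (supNorm u : ℝ) ^ 2 *
      |dressedEntryP (fun c'' a' => colH (KPerf (d := 3) Lc (sfStep Lc) (smStep 3 Lc) m) (Lc ^ m) a' 0 c'')
        (fun c' e s s' => if supNorm (s' - s) ≤ Lc ^ m then
          -((1 / 2 : ℝ) * κ m) * bubble (c m • blk (fun x z a b => Pker z x a b) true true) (a m • blk (V c' s) true true) (Ssl m e s' - a m • blk
            (V e s') true true) else 0)
        (((Lc ^ m : ℕ) : ℤ) • (-u)) μ ν| ≤ B7 6)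
    (hLmix : ∀ k ∈ JM, ∀ m : ℕ, 1 ≤ m → ∀ S' : Finset Pt, ∑ u ∈ S', (supNorm u : ℝ) ^ 2 *
      |dressedEntryP (fun c'' a' => colH (KPerf (d := 3) Lc (sfStep Lc) (smStep 3 Lc) m) (Lc ^ m) a' 0 c'') (Gmix k m)
        (((Lc ^ m : ℕ) : ℤ) • (-u)) μ ν| ≤ Bmix k)
    (hLgh : ∀ k ∈ JG, ∀ m : ℕ, 1 ≤ m → ∀ S' : Finset Pt, ∑ u ∈ S', (supNorm u : ℝ) ^ 2 *
      |dressedEntryP (fun c'' a' => colH (KPerf (d := 3) Lc (sfStep Lc) (smStep 3 Lc) m) (Lc ^ m) a' 0 c'') (Ggh k m)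
        (((Lc ^ m : ℕ) : ℤ) • (-u)) μ ν| ≤ Bgh k)
    (hLN : ∀ m : ℕ, 1 ≤ m → ∀ S' : Finset Pt, ∑ u ∈ S', (supNorm u : ℝ) ^ 2 *
      |dressedEntryP (fun c'' a' => colH (KPerf (d := 3) Lc (sfStep Lc) (smStep 3 Lc) m) (Lc ^ m) a' 0 c'')
        (fun c' e s s' => if supNorm (s' - s) ≤ Lc ^ m then FN m c' e s s' else 0)
        (((Lc ^ m : ℕ) : ℤ) • (-u)) μ ν| ≤ BN)
    -- THE WARD DOOR `hWj` OPENED DOWN TO the row root's hW-side TABLE LETTERS (`RowD1JointEndSymWard`, VERBATIM with `N ↦ Ncol`; `hWj` supplied inside by §1):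
    -- hW, first order: the (0.4) stencil Ward law of `tabs.V` ((S-V)⁰⁴, an1's `hVd_iff` form of (V-d))
    (hVd04 : ∀ u : Fin 4 → ℤ, divV tabs.V u = conjV (mfNeg (linSym04At (ctr 4 Lc) Lc)) (diagK (legInd (ctr 4 Lc) u)))
    -- hW, SECOND ORDER — THE TABLE LETTERS replacing the (Wd) socket of the root of record:
    -- (c1) the order-one consistency of the multiplier table with the Λ-sector at the symmetrised resolvents, every level
    (hc1 : ∀ (j : ℕ) (κ : Fin 4) (u : Fin 4 → ℤ),
      dM (Gsym Lc j) Lc (SpureSymOf tabs ((Lc : ℝ) ^ (3 + 1)) (-((Lc : ℝ) ^ (3 + 1) * (1 / 2) * (Lc : ℝ) ^ (3 + 1))) cΛ j) (tabs.M j) κ u = vertexOfK (Gsym Lc j) Lc (SsymOf tabs ((Lc : ℝ) ^ (3 + 1)) (-((Lc : ℝ) ^ (3 + 1) * (1 / 2) * (Lc : ℝ) ^ (3 + 1))) cΛ j) κ u)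
    -- (Sp)(Mp) the row parities of the first-order tables
    (hSp : ∀ (j : ℕ) (κ : Fin 4) (u : Fin 4 → ℤ), trK (SpureSymOf tabs ((Lc : ℝ) ^ (3 + 1)) (-((Lc : ℝ) ^ (3 + 1) * (1 / 2) * (Lc : ℝ) ^ (3 + 1))) cΛ j κ u) = -sgnK (SpureSymOf tabs ((Lc : ℝ) ^ (3 + 1)) (-((Lc : ℝ) ^ (3 + 1) * (1 / 2) * (Lc : ℝ) ^ (3 + 1))) cΛ j κ u))
    (hMp : ∀ (j : ℕ) (ρ : Fin 4) (w : Fin 4 → ℤ), trK (tabs.M j ρ w) = -sgnK (tabs.M j ρ w))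
    -- the second-order letters' remainders, their classes (one rate per level) and row parities
    (RW RW'' : (Fin 4 → ℤ) → Fin 4 → (Fin 4 → ℤ) → MKer 4 (Fib 3))
    (RB RB'' : ℕ → (Fin 4 → ℤ) → Fin 4 → (Fin 4 → ℤ) → MKer 4 (Fib 3))
    (RM : ℕ → (Fin 4 → ℤ) → Fin 4 → (Fin 4 → ℤ) → MKer 4 (Fib 3))
    (hcls0 : ∃ C δ : ℝ, 0 < δ ∧ (∀ Y, LocStencil (RW Y) C δ) ∧ (∀ Y, LocStencil (RW'' Y) C δ) ∧ (∀ Y, LocStencil (RB 0 Y) C δ) ∧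
      (∀ Y, LocStencil (RB'' 0 Y) C δ) ∧ (∀ y, VertexFamily (RM 0 y) Lc C δ))
    (hclsS : ∀ j : ℕ, ∃ C δ : ℝ, 0 < δ ∧ (∀ Y, LocStencil (RB (j + 1) Y) C δ) ∧ (∀ Y, LocStencil (RB'' (j + 1) Y) C δ) ∧
      (∀ y, VertexFamily (RM (j + 1) y) Lc C δ))
    (hRWp : ∀ Y κ u, trK (RW Y κ u) = -sgnK (RW Y κ u)) (hRW''p : ∀ Y κ u, trK (RW'' Y κ u) = -sgnK (RW'' Y κ u))
    (hRBp : ∀ j Y κ u, trK (RB j Y κ u) = -sgnK (RB j Y κ u)) (hRB''p : ∀ j Y κ u, trK (RB'' j Y κ u) = -sgnK (RB'' j Y κ u))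
    (hRMp : ∀ j y ρ' w, trK (RM j y ρ' w) = -sgnK (RM j y ρ' w))
    -- (T2-W) the level-0 Ward law of the Wilson bi-table `Lc⁸ • wilsonW₂ 3 ((8Ncol²)⁻¹ • wsym22 Ncol)` against `Lc⁴ • wilsonA 3`, both slots
    (hWil : ∀ (Y : Fin 4 → ℤ) (κ' : Fin 4) (u' : Fin 4 → ℤ),
      (stepScale 3 Lc 0 * (Lc : ℝ) ^ (3 + 1))⁻¹ • ∑ v ∈ box (3 + 1) Lc,
          divV (fun κ u => ((Lc : ℝ) ^ 8) • wilsonW₂ 3 ((8 * (Ncol : ℝ) ^ 2)⁻¹ • wsym22 Ncol) κ u κ' u') ((Lc : ℤ) • Y + toSite v) =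
        comp (((Lc : ℝ) ^ (3 + 1)) • wilsonA 3 κ' u') (diagK ((1 / 2 : ℝ) • ∑ v ∈ box (3 + 1) Lc, legInd (ctr (3 + 1) Lc) ((Lc : ℤ) • Y + toSite v)))
          - comp (diagK ((1 / 2 : ℝ) • ∑ v ∈ box (3 + 1) Lc, legInd (ctr (3 + 1) Lc) ((Lc : ℤ) • Y + toSite v))) (((Lc : ℝ) ^ (3 + 1)) • wilsonA 3 κ' u') + RW Y κ' u')
    (hWil'' : ∀ (Y : Fin 4 → ℤ) (κ : Fin 4) (u : Fin 4 → ℤ),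
      (stepScale 3 Lc 0 * (Lc : ℝ) ^ (3 + 1))⁻¹ • ∑ v ∈ box (3 + 1) Lc,
          divV (fun κ' u' => ((Lc : ℝ) ^ 8) • wilsonW₂ 3 ((8 * (Ncol : ℝ) ^ 2)⁻¹ • wsym22 Ncol) κ u κ' u') ((Lc : ℤ) • Y + toSite v) =
        comp (((Lc : ℝ) ^ (3 + 1)) • wilsonA 3 κ u) (diagK ((1 / 2 : ℝ) • ∑ v ∈ box (3 + 1) Lc, legInd (ctr (3 + 1) Lc) ((Lc : ℤ) • Y + toSite v)))
          - comp (diagK ((1 / 2 : ℝ) • ∑ v ∈ box (3 + 1) Lc, legInd (ctr (3 + 1) Lc) ((Lc : ℤ) • Y + toSite v))) (((Lc : ℝ) ^ (3 + 1)) • wilsonA 3 κ u) + RW'' Y κ u)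
    -- (T2-B) the Ward law of the second-order border table `tabs.vh₂S` against `tabs.V`, both slots, level 0 and level j+1
    (hBord0 : ∀ (Y : Fin 4 → ℤ) (κ' : Fin 4) (u' : Fin 4 → ℤ),
      (stepScale 3 Lc 0 * (Lc : ℝ) ^ (3 + 1))⁻¹ • ∑ v ∈ box (3 + 1) Lc, divV (fun κ u => cB • tabs.vh₂S κ u κ' u') ((Lc : ℤ) • Y + toSite v) =
        comp ((-((Lc : ℝ) ^ (3 + 1) * (1 / 2) * (Lc : ℝ) ^ (3 + 1))) • tabs.V κ' u') (diagK ((1 / 2 : ℝ) • ∑ v ∈ box (3 + 1) Lc, legInd (ctr (3 + 1) Lc) ((Lc : ℤ) • Y + toSite v)))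
          - comp (diagK ((1 / 2 : ℝ) • ∑ v ∈ box (3 + 1) Lc, legInd (ctr (3 + 1) Lc) ((Lc : ℤ) • Y + toSite v))) ((-((Lc : ℝ) ^ (3 + 1) * (1 / 2) * (Lc : ℝ) ^ (3 + 1))) • tabs.V κ' u') + RB 0 Y κ' u')
    (hBord0'' : ∀ (Y : Fin 4 → ℤ) (κ : Fin 4) (u : Fin 4 → ℤ),
      (stepScale 3 Lc 0 * (Lc : ℝ) ^ (3 + 1))⁻¹ • ∑ v ∈ box (3 + 1) Lc, divV (fun κ' u' => cB • tabs.vh₂S κ u κ' u') ((Lc : ℤ) • Y + toSite v) =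
        comp ((-((Lc : ℝ) ^ (3 + 1) * (1 / 2) * (Lc : ℝ) ^ (3 + 1))) • tabs.V κ u) (diagK ((1 / 2 : ℝ) • ∑ v ∈ box (3 + 1) Lc, legInd (ctr (3 + 1) Lc) ((Lc : ℤ) • Y + toSite v)))
          - comp (diagK ((1 / 2 : ℝ) • ∑ v ∈ box (3 + 1) Lc, legInd (ctr (3 + 1) Lc) ((Lc : ℤ) • Y + toSite v))) ((-((Lc : ℝ) ^ (3 + 1) * (1 / 2) * (Lc : ℝ) ^ (3 + 1))) • tabs.V κ u) + RB'' 0 Y κ u)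
    (hBordS : ∀ (j : ℕ) (Y : Fin 4 → ℤ) (κ' : Fin 4) (u' : Fin 4 → ℤ),
      (stepScale 3 Lc (j + 1) * (Lc : ℝ) ^ (3 + 1))⁻¹ • ∑ v ∈ box (3 + 1) Lc, divV (fun κ u => (cB * wB2 3 Lc (j + 1)) • tabs.vh₂S κ u κ' u') ((Lc : ℤ) • Y + toSite v) =
        comp (((-((Lc : ℝ) ^ (3 + 1) * (1 / 2) * (Lc : ℝ) ^ (3 + 1))) * wVH 3 Lc (j + 1)) • tabs.V κ' u') (diagK ((1 / 2 : ℝ) • ∑ v ∈ box (3 + 1) Lc, legInd (ctr (3 + 1) Lc) ((Lc : ℤ) • Y + toSite v)))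
          - comp (diagK ((1 / 2 : ℝ) • ∑ v ∈ box (3 + 1) Lc, legInd (ctr (3 + 1) Lc) ((Lc : ℤ) • Y + toSite v))) (((-((Lc : ℝ) ^ (3 + 1) * (1 / 2) * (Lc : ℝ) ^ (3 + 1))) * wVH 3 Lc (j + 1)) • tabs.V κ' u') + RB (j + 1) Y κ' u')
    (hBordS'' : ∀ (j : ℕ) (Y : Fin 4 → ℤ) (κ : Fin 4) (u : Fin 4 → ℤ),
      (stepScale 3 Lc (j + 1) * (Lc : ℝ) ^ (3 + 1))⁻¹ • ∑ v ∈ box (3 + 1) Lc, divV (fun κ' u' => (cB * wB2 3 Lc (j + 1)) • tabs.vh₂S κ u κ' u') ((Lc : ℤ) • Y + toSite v) =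
        comp (((-((Lc : ℝ) ^ (3 + 1) * (1 / 2) * (Lc : ℝ) ^ (3 + 1))) * wVH 3 Lc (j + 1)) • tabs.V κ u) (diagK ((1 / 2 : ℝ) • ∑ v ∈ box (3 + 1) Lc, legInd (ctr (3 + 1) Lc) ((Lc : ℤ) • Y + toSite v)))
          - comp (diagK ((1 / 2 : ℝ) • ∑ v ∈ box (3 + 1) Lc, legInd (ctr (3 + 1) Lc) ((Lc : ℤ) • Y + toSite v))) (((-((Lc : ℝ) ^ (3 + 1) * (1 / 2) * (Lc : ℝ) ^ (3 + 1))) * wVH 3 Lc (j + 1)) • tabs.V κ u) + RB'' (j + 1) Y κ u)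
    -- (T2-M₂) the Ward law of the mixed table `M2Of tabs.mixFF j` against `tabs.M j`, every level
    (hM₂ : ∀ (j : ℕ) (y : Fin 4 → ℤ) (ρ' : Fin 4) (w : Fin 4 → ℤ),
      (stepScale 3 Lc j * (Lc : ℝ) ^ (3 + 1))⁻¹ • ∑ v ∈ box (3 + 1) Lc, divV (fun κ u => M2Of 3 Lc tabs.mixFF j κ u ρ' w) ((Lc : ℤ) • y + toSite v) =
        comp (tabs.M j ρ' w) (diagK ((1 / 2 : ℝ) • ∑ v ∈ box (3 + 1) Lc, legInd (ctr (3 + 1) Lc) ((Lc : ℤ) • y + toSite v))) - comp (diagK ((1 / 2 : ℝ) • ∑ v ∈ box (3 + 1) Lc, legInd (ctr (3 + 1) Lc) ((Lc : ℤ) • y + toSite v))) (tabs.M j ρ' w) + RM j y ρ' w)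
    -- `hTj` is leaf-01's THEOREM `RoadLeftLiteralSwap.hTj_JsB12Sym` (inside, unchanged); (SDF) and the W-slot split — VERBATIM
    (hSDF : ∀ m : ℕ, 1 ≤ m → B12Beta.secondMoment (defect
      (fun m => hessKer (KPerf (d := 3) Lc (sfStep Lc) (smStep 3 Lc) m)
        (vertexOfK (KPerf (d := 3) Lc (sfStep Lc) (smStep 3 Lc) m) (Lc ^ m) (SPerfOf (sfStep Lc) (smStep 3 Lc) (fun j _ =>
          (JsB12Sym hOdd Ncol tabs cΛ cB j).S) m)) (WPerfOf (sfStep Lc) (smStep 3 Lc) Wt m))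
      (fun m a b z => ((Lc ^ m : ℕ) : ℝ) ^ 8 * dressedEntry (colOf (KPerf (d := 3) Lc (sfStep Lc) (smStep 3 Lc) m))
        (hessKer (KPerf (d := 3) Lc (sfStep Lc) (smStep 3 Lc) 1)
          (vertexOfK (KPerf (d := 3) Lc (sfStep Lc) (smStep 3 Lc) 1) Lc (SPerfOf (sfStep Lc) (smStep 3 Lc) (fun j _ =>
            (JsB12Sym hOdd Ncol tabs cΛ cB j).S) 1)) (WPerfOf (sfStep Lc) (smStep 3 Lc) Wt 1))
        (((Lc ^ m : ℕ) : ℤ) • z) a b) m) μ ν = 0)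
    -- the W-slot split of the perfect second-order slot (row #14): the split, ONE `VertexFamily₂` letter of the EXTRA slot `Wx m`, and the extra piece's
    -- bound ((G8)∕(G-mix-W)); `hloc₀`∕`hs₀` (bi-vertex slot) and `hlocx`∕`hsx` (extra slot) are supplied inside (`BiVertexSlotLetters` §4)
    {Wx : ℕ → Fin (3 + 1) → (Fin (3 + 1) → ℤ) → Fin (3 + 1) → (Fin (3 + 1) → ℤ) → MKer (3 + 1) (Fib 3)}
    (hsplit : ∀ m : ℕ, 1 ≤ m →
      WPerfOf (sfStep Lc) (smStep 3 Lc) Wt m = vertex2OfK (KPerf (d := 3) Lc (sfStep Lc) (smStep 3 Lc) m) (Lc ^ m) (Wf m) + Wx m)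
    (hWx : ∀ m : ℕ, 1 ≤ m → ∃ Cx δx : ℝ, 0 < δx ∧ VertexFamily₂ (Wx m) (Lc ^ m) Cx δx)
    {B : ℝ}
    (hextra : ∀ m : ℕ, 1 ≤ m →
      |B12Beta.secondMoment
          (fun μ' ν' z => (1 / 2 : ℝ) * tadpole (KPerf (d := 3) Lc (sfStep Lc) (smStep 3 Lc) m) (Wx m μ' 0 ν' z)) μ ν| ≤ B) :
    D1Drift Lc (JsB12Sym hOdd Ncol tabs cΛ cB) N μ ν :=
  d1Drift_JsB12Sym_of_sliceLedger_straight hLc hOdd Ncol tabs cΛ cB Wt hWt1 hS0 hSall0 hW0 hWall0 hδS hδW hθS0 hθS1 hθW0 hθW1 wg wgh hδ hV hW hcovV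
    hcovW X hX hW1 hW2 hKcov h0V hgermV hWloc hn hμν hWf hCF haf hfar hunits₁ hunits₂ hRb hSsl hWsl hslice JM hmix hGmix JG hgh hGgh hFN hL0 hL1 hL2 hL3
    hL4 hL5 hL6 hLmix hLgh hLN
    (hWj_JsB12Sym_of_wardTables hOdd Ncol tabs cΛ cB hVd04 hc1 hSp hMp RW RW'' RB RB'' RM hcls0 hclsS hRWp hRW''p hRBp hRB''p hRMp hWil hWil'' hBord0
      hBord0'' hBordS hBordS'' hM₂)
    hSDF hsplit hWx hextra

end Summit.QuantumFields.BalabanUV.Beta.FP.RoadLeftLiteralWard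

end
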